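import Mathlib.Topology.Compactification.OnePoint.Basic
import Mathlib.Geometry.Manifold.IsManifold.InteriorBoundary
import Literature.Topology.FourManifolds.HomotopySpheresBP
import Literature.Topology.FourManifolds.LatticeForms
import Literature.AlgebraicTopology.SingularHomology.IntersectionForm
import HarnessLib

/-!
# The capped-off bounding manifold `W/∂W` and the signature of a null-cobordism

Trunk T-4MAN (`FourManifolds`). For a null-cobordism `M = ∂W` (`Literature.Topology.FourManifolds.NullCobordism`,
`HomotopySpheresBP.lean`) we construct the compact Hausdorff space `W/∂W` obtained by collapsing
the boundary to a point — realised as the one-point compactification of the interior `W ∖ ∂W`,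
`Literature.Topology.FourManifolds.NullCobordism.Capped` — together with the collapse map `W → W/∂W`, and define the
**signature** of an oriented null-cobordism of odd dimension `n = 2k - 1` as the signature of the
cup-product form `(a, b) ↦ ⟨a ⌣ b, [W/∂W]⟩` on `Hᵏ(W/∂W; ℤ)/torsion`
(`Literature.Topology.FourManifolds.NullCobordism.signature`), i.e. the tree's `Literature.AlgebraicTopology.SingularHomology.intersectionForm` (closed case,
`Literature/AlgebraicTopology/SingularHomology/IntersectionForm.lean`) of the capped space, with
`LinearMap.BilinForm.signature` of `LatticeForms.lean`.

This is the signature `σ(W)` of Kervaire–Milnor, *Groups of homotopy spheres I*, Ann. of Math. 77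
(1963), §7, in the form they use it for bounded manifolds (proof of Lemma 7.3, pp. 528–529: "The
fact that `M` has a boundary does not matter here, since we can adjoin a cone over the boundary,
thus obtaining a closed homology manifold with the same signature"): `W ∪ cone(∂W) = W/∂W`, and
`H̃ᵏ(W/∂W) ≅ Hᵏ(W, ∂W)` (Hatcher, *Algebraic Topology* (2002), Prop. 2.22, `∂W` being collared),
under which the cup-product form of `W/∂W` evaluated on the image of `[W, ∂W]` is the
intersection form of `(W, ∂W)` (Hatcher, §3.3, Thm. 3.43 and the discussion of cup product
pairings for manifolds with boundary, p. 254). It is the entry notion for the deeper layers of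
`|bP₈| = 28` (`HomotopySpheresBPOrder.lean`, `HomotopySpheresSignature.lean`): Kervaire–Milnor's
Thm. 7.5 / Cor. 7.6 and
Kosinski's Prop. X.6.2 are statements about `σ(W)` for parallelizable `W⁴ᵐ` bounded by homotopy
spheres.

## Main definitions

* `NullCobordism.interior c : Set c.W`: the interior `W ∖ ∂W` of the bounding manifold (Mathlib's
  `ModelWithCorners.interior`); open, the complement of `range c.incl = ∂W`.
* `NullCobordism.Capped c`: `W/∂W := OnePoint (W ∖ ∂W)`, a compact Hausdorff space; the point
  `∞` is the image of the boundary.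
* `NullCobordism.collapse c : c.W → c.Capped`: the quotient map (identity on the interior,
  `∂W ↦ ∞`); continuous and surjective (for nonempty boundary).
* `NullCobordism.cappedIntersectionForm c h μ`, `NullCobordism.signature c h μ`: for
  `h : k + k = n + 1` and a homological `ℤ`-orientation `μ` of `W/∂W` in dimension `n + 1`, the
  form `⟨a ⌣ b, [W/∂W]⟩` on `Hᵏ(W/∂W; ℤ)/T` and its signature `σ(W, μ) ∈ ℤ`.

## Design choices

* **Why `OnePoint` of the interior.** For an open subset `U` of a compact Hausdorff space `W`,
  the one-point compactification `U⁺` is canonically homeomorphic to `W/(W ∖ U)`; with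
  `U = W ∖ ∂W` this is `W/∂W = W ∪ cone(∂W)`. This avoids quotient types and collars, and all the
  point-set facts needed (`CompactSpace`, `T2Space`) are Mathlib instances once the interior is
  known to be open (`ModelWithCorners.isOpen_interior`) in the compact Hausdorff `W`.
* **Orientations are homological and live on `W/∂W`.** The tree's intersection form takes an
  `Literature.HomologicalOrientation ℤ X (n + 1)` (a coherent choice of generators of the local homology
  groups); on `W/∂W` such an orientation exists iff `W` is orientable and `∂W` is connected (at `∞`
  the local homology is `H̃ₙ(∂W)`), which is the case of interest (`∂W` a homotopy sphere, `W`
  parallelizable). Its restriction to the interior is an orientation of the open manifold `W ∖ ∂W`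
  in the usual sense. No comparison with smooth orientations (`Literature.Topology.FourManifolds.SmoothOrientation`) is made
  here; statements needing a sign convention relative to the orientation of the boundary homotopy
  sphere must supply it.
* **No manifold structure on `W/∂W` is asserted.** `W/∂W` is a topological manifold only when `∂W`
  is a sphere; Kervaire–Milnor's "closed homology manifold" suffices for the signature, and the
  tree's `intersectionForm`/`fundamentalClass` are defined for every compact space (with junk value
  `0` for the fundamental class if none exists, `FundamentalClass.lean`).
* `k` and the degree equation `h : k + k = n + 1` are explicit, as in `Literature.AlgebraicTopology.SingularHomology.intersectionForm`; for
  `bP₈` one takes `n = 7`, `k = 4`.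

## References

* M. Kervaire, J. Milnor, *Groups of homotopy spheres I*, Ann. of Math. 77 (1963): §7, p. 528
  (intersection pairing of a `2k`-manifold bounded by a homology sphere), proof of Lemma 7.3,
  pp. 528–529 (cone over the boundary), Thm. 7.5, Cor. 7.6. [KervaireMilnorAnnals1963]
* A. Hatcher, *Algebraic Topology* (2002): Prop. 2.22 (`H̃ⁿ(X/A) ≅ Hⁿ(X, A)` for good pairs),
  §3.3 Thm. 3.43 (Lefschetz duality) and p. 254 (cup product pairing for manifolds with
  boundary). [Hatcher2002]
* A. Kosinski, *Differential Manifolds* (1993), Ch. X §3 (proof of Prop. 3.3: "attaching to `M` a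
  cone on `∂M` produces a homology manifold ... with the same signature") and §6 (the signature
  homomorphism `σ : P⁴ⁿ → ℤ`). [Kosinski1993]
-/

open scoped Manifold ContDiff Topology
open Set Function

noncomputable section

namespace Literature.Topology.FourManifolds

universe u

namespace NullCobordism

variable {n : ℕ} {M : Type u} [TopologicalSpace M] [ChartedSpace (EuclideanSpace ℝ (Fin n)) M]

/-! ### The interior of the bounding manifold -/

/-- The **interior** `W ∖ ∂W` of the bounding manifold of a null-cobordism `M = ∂W`, as a subset of
`W`: Mathlib's `ModelWithCorners.interior` for the model `𝓡∂ (n + 1)` (the points with a chart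
mapping them to the interior of the half-space). [folklore] -/
protected def interior (c : NullCobordism n M) : Set c.W :=
  (𝓡∂ (n + 1)).interior c.W

/-- The interior of the bounding manifold is the complement of its boundary `∂W`
(Mathlib's `ModelWithCorners.compl_boundary`). [folklore] -/
theorem interior_eq_compl_boundary (c : NullCobordism n M) :
    c.interior = ((𝓡∂ (n + 1)).boundary c.W)ᶜ :=
  ((𝓡∂ (n + 1)).compl_boundary (M := c.W)).symm

/-- The interior of the bounding manifold is the complement of the image of the boundary
inclusion `M ↪ W` (`range c.incl = ∂W`). [folklore] -/
theorem interior_eq_compl_range_incl (c : NullCobordism n M) : c.interior = (range c.incl)ᶜ := by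
  rw [interior_eq_compl_boundary, c.range_incl]

/-- A point of `W` lies in the interior iff it is not in the image of `M = ∂W`. [folklore] -/
theorem mem_interior_iff_notMem_range (c : NullCobordism n M) (x : c.W) :
    x ∈ c.interior ↔ x ∉ range c.incl := by
  rw [interior_eq_compl_range_incl, mem_compl_iff]

/-- Boundary points `incl z` are not interior points. [folklore] -/
theorem incl_notMem_interior (c : NullCobordism n M) (z : M) : c.incl z ∉ c.interior := by
  rw [mem_interior_iff_notMem_range, not_not]
  exact mem_range_self z

/-- **The interior of the bounding manifold is open** (Mathlib's `ModelWithCorners.isOpen_interior`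
for `C¹` manifolds with corners, here `C^∞`). [folklore] -/
theorem isOpen_interior (c : NullCobordism n M) : IsOpen c.interior :=
  (𝓡∂ (n + 1)).isOpen_interior (M := c.W) (n := ∞) (by simp)

/-- The image of the boundary inclusion is closed in `W` (it is compact, `M ≅ ∂W` being a closed
subset of the compact `W`; here: the complement of the open interior). [folklore] -/
theorem isClosed_range_incl (c : NullCobordism n M) : IsClosed (range c.incl) := by
  rw [← compl_compl (range c.incl), ← interior_eq_compl_range_incl, isClosed_compl_iff]
  exact c.isOpen_interior

/-- The interior `W ∖ ∂W`, an open subset of the compact Hausdorff `W`, is locally compact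
(Mathlib's `IsOpen.locallyCompactSpace`). [folklore] -/
instance locallyCompactSpace_interior (c : NullCobordism n M) : LocallyCompactSpace c.interior :=
  c.isOpen_interior.locallyCompactSpace

/-! ### The capped space `W/∂W` -/

/-- **The capped-off bounding manifold `W/∂W = W ∪ cone(∂W)`** of a null-cobordism `M = ∂W`,
realised as the one-point compactification of the interior `W ∖ ∂W` (for an open subset `U` of a
compact Hausdorff space `W`, `U⁺ ≅ W/(W ∖ U)` canonically). Kervaire–Milnor, *Groups of homotopy
spheres I* (1963), §7, proof of Lemma 7.3, pp. 528–529: "we can adjoin a cone over the boundary,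
thus obtaining a closed homology manifold with the same signature". The extra point `∞` is the
cone point, the image of `∂W`. [cite: KervaireMilnorAnnals1963, §7, proof of Lemma 7.3 (pp. 528–529)] -/
def Capped (c : NullCobordism n M) : Type u :=
  OnePoint c.interior

/-- The topology of `W/∂W`: that of the one-point compactification of the interior. [folklore] -/
instance topologicalSpace_capped (c : NullCobordism n M) : TopologicalSpace c.Capped :=
  inferInstanceAs (TopologicalSpace (OnePoint c.interior))

/-- `W/∂W` is compact (a one-point compactification). [folklore] -/
instance compactSpace_capped (c : NullCobordism n M) : CompactSpace c.Capped :=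
  inferInstanceAs (CompactSpace (OnePoint c.interior))

/-- `W/∂W` is Hausdorff: the interior is a locally compact Hausdorff space (indeed `W/∂W` is
normal, `T4Space`). [folklore] -/
instance t2Space_capped (c : NullCobordism n M) : T2Space c.Capped :=
  inferInstanceAs (T2Space (OnePoint c.interior))

/-- The cone point `∞ ∈ W/∂W`, the image of the boundary. [folklore] -/
def Capped.pt (c : NullCobordism n M) : c.Capped :=
  (OnePoint.infty : OnePoint c.interior)

/-- The open embedding of the interior `W ∖ ∂W` into `W/∂W` (Mathlib's `OnePoint.some`).
[folklore] -/
def Capped.ofInterior (c : NullCobordism n M) (x : c.interior) : c.Capped :=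
  ((x : c.interior) : OnePoint c.interior)

/-- The inclusion of the interior into `W/∂W` is an open embedding
(`OnePoint.isOpenEmbedding_coe`). [folklore] -/
theorem Capped.isOpenEmbedding_ofInterior (c : NullCobordism n M) :
    Topology.IsOpenEmbedding (Capped.ofInterior c) :=
  OnePoint.isOpenEmbedding_coe

/-- Interior points of `W/∂W` are distinct from the cone point (`OnePoint.coe_ne_infty`).
[folklore] -/
theorem Capped.ofInterior_ne_pt (c : NullCobordism n M) (x : c.interior) :
    Capped.ofInterior c x ≠ Capped.pt c :=
  OnePoint.coe_ne_infty x

/-- Every point of `W/∂W` is the cone point or an interior point (`OnePoint.rec`). [folklore] -/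
theorem Capped.eq_pt_or_exists (c : NullCobordism n M) (p : c.Capped) :
    p = Capped.pt c ∨ ∃ x : c.interior, Capped.ofInterior c x = p := by
  induction p using OnePoint.rec with
  | infty => exact Or.inl rfl
  | coe x => exact Or.inr ⟨x, rfl⟩

/-! ### The collapse map `W → W/∂W` -/

open Classical in
/-- **The collapse map `W → W/∂W`**: the identity on the interior and the constant map to the cone
point `∞` on `∂W` (the quotient map of `W ∪ cone(∂W) ← W`; Kervaire–Milnor 1963, proof of
Lemma 7.3). [cite: KervaireMilnorAnnals1963, §7, proof of Lemma 7.3 (pp. 528–529)] -/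
def collapse (c : NullCobordism n M) (x : c.W) : c.Capped :=
  if h : x ∈ c.interior then Capped.ofInterior c ⟨x, h⟩ else Capped.pt c

/-- On interior points the collapse map is the inclusion of the interior. [folklore] -/
theorem collapse_of_mem {c : NullCobordism n M} {x : c.W} (h : x ∈ c.interior) :
    c.collapse x = Capped.ofInterior c ⟨x, h⟩ := by
  classical
  exact dif_pos h

/-- The collapse map restricted to the interior (as a subtype) is the inclusion. [folklore] -/
@[simp] theorem collapse_coe (c : NullCobordism n M) (x : c.interior) :
    c.collapse x = Capped.ofInterior c x :=
  collapse_of_mem x.2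

/-- Off the interior, i.e. on `∂W`, the collapse map is the cone point. [folklore] -/
theorem collapse_of_notMem {c : NullCobordism n M} {x : c.W} (h : x ∉ c.interior) :
    c.collapse x = Capped.pt c := by
  classical
  exact dif_neg h

/-- The boundary `∂W = incl(M)` is collapsed to the cone point: `collapse (incl z) = ∞`.
[folklore] -/
@[simp] theorem collapse_incl (c : NullCobordism n M) (z : M) :
    c.collapse (c.incl z) = Capped.pt c :=
  collapse_of_notMem (c.incl_notMem_interior z)

/-- A point of `W` is collapsed to the cone point iff it is a boundary point. [folklore] -/
theorem collapse_eq_pt_iff (c : NullCobordism n M) (x : c.W) :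
    c.collapse x = Capped.pt c ↔ x ∈ range c.incl := by
  by_cases h : x ∈ c.interior
  · rw [collapse_of_mem h]
    refine ⟨fun h' => absurd h' (Capped.ofInterior_ne_pt c _), fun h' => ?_⟩
    exact absurd h' ((c.mem_interior_iff_notMem_range x).1 h)
  · rw [collapse_of_notMem h]
    exact ⟨fun _ => by rwa [c.mem_interior_iff_notMem_range, not_not] at h, fun _ => rfl⟩

/-- The collapse map is injective on the interior: `collapse x = collapse y` with `x` interior
forces `x = y`. [folklore] -/
theorem collapse_injOn_interior (c : NullCobordism n M) : InjOn c.collapse c.interior := by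
  intro x hx y hy hxy
  rw [collapse_of_mem hx, collapse_of_mem hy] at hxy
  exact congrArg Subtype.val (OnePoint.coe_injective hxy)

/-- The collapse map is surjective as soon as the boundary is nonempty (the cone point is then
hit); interior points are always hit. [folklore] -/
theorem collapse_surjective (c : NullCobordism n M) [Nonempty M] : Surjective c.collapse := by
  intro p
  rcases Capped.eq_pt_or_exists c p with rfl | ⟨x, rfl⟩
  · exact ⟨c.incl (Classical.arbitrary M), c.collapse_incl _⟩
  · exact ⟨x, c.collapse_coe x⟩

/-- **The collapse map `W → W/∂W` is continuous.** On the open interior it is the open embedding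
into the one-point compactification; at a boundary point `b`, a basic neighbourhood of `∞` is the
complement of a compact (hence closed in the Hausdorff `W`) subset `K` of the interior, and its
preimage `W ∖ K` is an open neighbourhood of `b`. [folklore] -/
theorem continuous_collapse (c : NullCobordism n M) : Continuous c.collapse := by
  classical
  rw [continuous_def]
  intro s hs
  by_cases hinf : Capped.pt c ∈ s
  · -- `s = (K)ᶜ ∪ {∞}` with `K` closed and compact in the interior
    obtain ⟨hclosed, hcompact⟩ := (OnePoint.isOpen_iff_of_mem hinf).1 hs
    -- the preimage is the complement in `W` of the image of `K`
    set K : Set c.interior := (((↑) : c.interior → OnePoint c.interior) ⁻¹' s)ᶜ with hK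
    have hKc : IsCompact (((↑) : c.interior → c.W) '' K) := hcompact.image continuous_subtype_val
    have hpre : c.collapse ⁻¹' s = (((↑) : c.interior → c.W) '' K)ᶜ := by
      ext x
      simp only [mem_preimage, mem_compl_iff, mem_image, hK, Subtype.exists, exists_and_right,
        exists_eq_right, not_exists, not_not]
      by_cases hx : x ∈ c.interior
      · rw [collapse_of_mem hx]
        exact ⟨fun h _ => h, fun h => h hx⟩
      · rw [collapse_of_notMem hx]
        exact ⟨fun _ h' => absurd h' hx, fun _ => hinf⟩
    rw [hpre, isOpen_compl_iff]
    exact hKc.isClosed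
  · -- `∞ ∉ s`: the preimage lies in the interior, where `collapse` is the open embedding
    have hs' : IsOpen (((↑) : c.interior → OnePoint c.interior) ⁻¹' s) :=
      (OnePoint.isOpen_iff_of_notMem hinf).1 hs
    have hpre : c.collapse ⁻¹' s =
        ((↑) : c.interior → c.W) '' (((↑) : c.interior → OnePoint c.interior) ⁻¹' s) := by
      ext x
      simp only [mem_preimage, mem_image, Subtype.exists, exists_and_right, exists_eq_right]
      by_cases hx : x ∈ c.interior
      · rw [collapse_of_mem hx]
        exact ⟨fun h => ⟨hx, h⟩, fun ⟨_, h⟩ => h⟩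
      · rw [collapse_of_notMem hx]
        exact ⟨fun h => absurd h hinf, fun ⟨h, _⟩ => absurd h hx⟩
    rw [hpre]
    exact c.isOpen_interior.isOpenMap_subtype_val _ hs'

/-- The collapse map as a bundled continuous map `C(W, W/∂W)`. [folklore] -/
def collapseMap (c : NullCobordism n M) : C(c.W, c.Capped) :=
  ⟨c.collapse, c.continuous_collapse⟩

/-- The bundled collapse map is the collapse map (definitional). [folklore] -/
@[simp] theorem collapseMap_apply (c : NullCobordism n M) (x : c.W) :
    c.collapseMap x = c.collapse x :=
  rfl

/-! ### The signature of an oriented null-cobordism -/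

/-- **The intersection form of the capped space.** For a null-cobordism `M = ∂W` of dimension
`n + 1 = k + k` and a homological `ℤ`-orientation `μ` of `W/∂W` in dimension `n + 1`, the bilinear
form `([a], [b]) ↦ ⟨a ⌣ b, [W/∂W]⟩` on `Hᵏ(W/∂W; ℤ)/torsion` — the tree's `Literature.AlgebraicTopology.SingularHomology.intersectionForm` of
the compact space `W/∂W`. Under `H̃ᵏ(W/∂W) ≅ Hᵏ(W, ∂W)` (Hatcher 2002, Prop. 2.22) this is the
intersection form of `(W, ∂W)`, whose homological version for a `2k`-manifold bounded by a
homology sphere is Kervaire–Milnor's pairing `HₖM ⊗ HₖM → ℤ` "of determinant `±1`" (1963, §7,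
p. 528). [cite: KervaireMilnorAnnals1963, §7, p. 528 and proof of Lemma 7.3 (pp. 528–529)] [cite: Hatcher2002, Prop. 2.22 and §3.3 p. 254] -/
def cappedIntersectionForm (c : NullCobordism n M) {k : ℕ} (h : k + k = n + 1)
    (μ : Literature.AlgebraicTopology.SingularHomology.HomologicalOrientation ℤ c.Capped (n + 1)) :
    LinearMap.BilinForm ℤ ↥(Literature.AlgebraicTopology.SingularHomology.freeCohomology ℤ c.Capped k) :=
  Literature.AlgebraicTopology.SingularHomology.intersectionForm h μ

/-- The capped intersection form is the tree's intersection form of `W/∂W` (definitional).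
[folklore] -/
@[simp] theorem cappedIntersectionForm_eq (c : NullCobordism n M) {k : ℕ} (h : k + k = n + 1)
    (μ : Literature.AlgebraicTopology.SingularHomology.HomologicalOrientation ℤ c.Capped (n + 1)) :
    c.cappedIntersectionForm h μ = Literature.AlgebraicTopology.SingularHomology.intersectionForm h μ :=
  rfl

/-- **The signature `σ(W, μ)` of an oriented null-cobordism** `M = ∂W` of dimension
`n + 1 = k + k`: the signature `b⁺ - b⁻` (`LinearMap.BilinForm.signature`, `LatticeForms.lean`) of
the cup-product form of the capped space `W/∂W = W ∪ cone(∂W)` with respect to the homological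
`ℤ`-orientation `μ`. This is Kervaire–Milnor's `σ(M)` for manifolds with boundary (*Groups of
homotopy spheres I* (1963), §7: footnote 4 p. 508 for the word "signature"; p. 528 and the proof of
Lemma 7.3, pp. 528–529, "adjoin a cone over the boundary, thus obtaining a closed homology
manifold with the same signature"; used in Lemma 7.4, Thm. 7.5, Cor. 7.6) and Kosinski's
signature homomorphism `σ : P⁴ⁿ → ℤ` (*Differential Manifolds* (1993), Ch. X §3 and proof of
Prop. 6.2). Meaningful for `W` compact oriented with connected boundary (then `μ` exists and is
`±` unique on each component); in general it inherits the junk conventions of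
`Literature.AlgebraicTopology.SingularHomology.intersectionForm` (fundamental class `0` if none exists) and of
`LinearMap.BilinForm.signature`. [cite: KervaireMilnorAnnals1963, §7, pp. 528–529 (proof of Lemma 7.3) and Thm. 7.5] [cite: Kosinski1993, Ch. X §6, proof of Prop. 6.2 (σ : P⁴ⁿ → ℤ)] -/
def signature (c : NullCobordism n M) {k : ℕ} (h : k + k = n + 1)
    (μ : Literature.AlgebraicTopology.SingularHomology.HomologicalOrientation ℤ c.Capped (n + 1)) : ℤ :=
  (c.cappedIntersectionForm h μ).signature

/-- Unfolding lemma: `σ(W, μ)` is the signature of the intersection form of `W/∂W`. [folklore] -/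
theorem signature_eq (c : NullCobordism n M) {k : ℕ} (h : k + k = n + 1)
    (μ : Literature.AlgebraicTopology.SingularHomology.HomologicalOrientation ℤ c.Capped (n + 1)) :
    c.signature h μ = (Literature.AlgebraicTopology.SingularHomology.intersectionForm h μ).signature :=
  rfl

end NullCobordism

end Literature.Topology.FourManifolds
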